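import Summits.QuantumFields.YangMills.Theorems.BalabanUVNodesN19LawPriceJackson
import Summits.QuantumFields.YangMills.Theorems.BalabanUVNodesN19LawPriceLowerRate

/-!
# YM-DAG node N19 (= NE7 proper) — THE LAW-LEVEL PRICE IS EXACTLY `log(e+L)∕(1+L)` (two-sided)

Cell `pub-ymgap`, HUMAN RULING D-0062 (Track A), R141 (C) wider-strategy seat `pub-ymgap-dag-n19-e` (strategy s3 = ALTERNATIVE CURRENCY), generation
g18, module 3.  Route `Summits/QuantumFields/YangMills/Theses/BalabanUVNodes.lean` rev 25, cluster item K3⁷ «SpineGivenEndpointR13SepCoPH»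
(stmt-QuantumFields-20544, dag-lead WORDS-143); filed `--supports` that item `--as helper` (it proves no registered stub).  COUNT-NEUTRAL: elementary real
analysis over Mathlib (`Nat.find`, `Nat.factorial_le_pow`, `Real.exp_half`, `Real.log_le_iff_le_exp`) + the seat's p554543 `…N19LawPriceJackson`
(`abs_integral_sub_integral_le_lipschitz_jackson`, `integrable_of_continuous_Icc_symm`), p548987 `…N19LawPriceModulus` (`max_pow_mul_le_sqrt`) and
p553677 `…N19LawPriceLowerRate` (`law_price_ge_logRate`) BY NAME; no scheme object, no Theses import; NOT a discharge claim.

THE RESULT.  For two probability laws on `[−1,1]` whose cgf's are `ε`-close on a window `|t| ≤ l₀` (`0 < ε ≤ 1`, `L = log⁺ε⁻¹`) and a test function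
`g`, `K`-Lipschitz with `|g| ≤ G` on `[−1,1]`:
★★ `law_price_le_logRate` — `|∫ g dν − ∫ g dμ| ≤ 384·c(l₀)·(K+G)·log(e+L)∕(1+L)`, `c(l₀) = 6 + l₀ + log max(1, 4e∕l₀)`: the Jackson-road bound of p554543
`16K∕n + (n+1)(G+8K∕n)·nⁿ·(n!·2εe^{l₀}·Aⁿ)` with p548987's trade `Aⁿε ≤ max(1,4en∕l₀)ⁿ√ε` (§1: `n·Ψ(n) ≤ e^{c n log(e+n)}`) at the level
`n = max{m : 2c·m·log(e+m) ≤ L}` (§2, `Nat.find`: `1∕n ≤ 16c·log(e+L)∕(1+L)` and `Ψ(n)√ε ≤ 1∕n`); small `L` by the trivial bound `2G`.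
★★ `law_price_two_sided` — that upper bound together with p553677's lower rate: for every `ε₀ > 0` a pair of laws (on `[0,1] ⊂ [−1,1]`) with cgf's
`ε`-close, `0 < ε ≤ min(ε₀,1)`, and a `1`-Lipschitz `[0,1]`-valued `g` paid `≥ log(e+L)∕(12(1+L))`.  So `log(e+L)∕(1+L)` IS the law-level
(bounded-Lipschitz) price of N19's window currency, two-sided up to the `l₀`-constant `4608·c(l₀)` — the law analogue of p517472 `sharp_price_two_sided`
(expectations: `P(ε) = ε(1+L)∕log(e+L)`) and p539220 ∕ p530176 (tilted means): every currency of the seat is now priced two-sidedly; the weakest, the law,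
loses all powers of `ε` and keeps only `log L∕L` (with geometric remainders `δ_K ≍ θ^K`: `dist_BL ≍ log K∕K`).  v14's STILL-OPEN (j) CLOSED; the Bernstein
road's `√`-gap (p546312 ∕ p548987 ∕ p550501 headers «NOT CLAIMED: the optimal modulus — Jackson's theorem») was the tool's, not the problem's.

HONEST FRAMING (binding).  Elementary and [folklore]; constants not optimised; NO consumer in the DAG today (optimality of the seat's own currency: what g9's
continuum law p504707 ∕ p505344 can carry).  Nothing of Bałaban's is instantiated; NE7 ∕ NE7b ∕ NE7c NOT PRINTED, NOT proved; N19 NOT discharged;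
count-neutral.  One finite `T⁴` programme at fixed `ε`; nothing continuum ∕ `ℝ⁴` ∕ OS ∕ mass-gap ∕ Clay.  0 `def` ∕ 0 `sorry`.
-/

noncomputable section

open Real Finset MeasureTheory ProbabilityTheory

namespace Summit.QuantumFields.YangMills.Theorems.BalabanUVNodesN19LawPriceTwoSided

open Summit.QuantumFields.YangMills.Theorems.BalabanUVNodesN19LawPriceJackson
  (abs_integral_sub_integral_le_lipschitz_jackson integrable_of_continuous_Icc_symm)
open Summit.QuantumFields.YangMills.Theorems.BalabanUVNodesN19LawPriceModulus (max_pow_mul_le_sqrt)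
open Summit.QuantumFields.YangMills.Theorems.BalabanUVNodesN19LawPriceLowerRate (law_price_ge_logRate)

/-! ## §1 The growth of the conversion factor: `n·Ψ(n) ≤ e^{c(l₀)·n·log(e+n)}` -/

/-- **GROWTH OF THE CONVERSION FACTOR.**  For `n ≥ 1`, with `Ψ(n) = (n+1)·nⁿ·(n!·2e^{l₀}·max(1,4en∕l₀)ⁿ)` (p554543 §4's factor after p548987's
trade): `log(n·Ψ(n)) ≤ c(l₀)·n·log(e+n)`, `c(l₀) = 6 + l₀ + log max(1, 4e∕l₀)` (`n, n+1 ≤ e+n`, `n! ≤ nⁿ ≤ (e+n)ⁿ`, `max(1,4en∕l₀) ≤ max(1,4e∕l₀)(e+n)`).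
[folklore] -/
theorem log_conversion_le {l₀ : ℝ} (hl₀ : 0 < l₀) {n : ℕ} (hn : 1 ≤ n) :
    Real.log ((n : ℝ) * ((n + 1) * (n : ℝ) ^ n * (n.factorial * (2 * Real.exp l₀) * (max 1 (4 * Real.exp 1 * n / l₀)) ^ n))) ≤
      (6 + l₀ + Real.log (max 1 (4 * Real.exp 1 / l₀))) * (n * Real.log (Real.exp 1 + n)) := by
  have hnr : (1 : ℝ) ≤ n := by exact_mod_cast hn
  have hn0 : (0 : ℝ) < n := by linarith
  set E : ℝ := Real.exp 1 + n with hE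
  have he1 : (1 : ℝ) + 1 ≤ Real.exp 1 := by have := Real.add_one_le_exp (1 : ℝ); linarith
  have hE1 : Real.exp 1 ≤ E := by rw [hE]; linarith
  have hEn : (n : ℝ) ≤ E := by rw [hE]; linarith [Real.exp_pos 1]
  have hEn1 : (n : ℝ) + 1 ≤ E := by rw [hE]; linarith
  have hE0 : 0 < E := by linarith
  set ℓ : ℝ := Real.log E with hℓ
  have hℓ1 : 1 ≤ ℓ := by
    rw [hℓ, ← Real.log_exp 1]
    exact Real.log_le_log (Real.exp_pos 1) hE1
  set a₀ : ℝ := max 1 (4 * Real.exp 1 / l₀) with ha₀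
  have ha₀1 : 1 ≤ a₀ := le_max_left _ _
  have ha₀0 : 0 < a₀ := by positivity
  -- `A' ≤ a₀·E`
  have hA' : max 1 (4 * Real.exp 1 * n / l₀) ≤ a₀ * E := by
    refine max_le ?_ ?_
    · calc (1 : ℝ) = 1 * 1 := by ring
        _ ≤ a₀ * E := mul_le_mul ha₀1 (by linarith) zero_le_one ha₀0.le
    · calc 4 * Real.exp 1 * n / l₀ = (4 * Real.exp 1 / l₀) * n := by ring
        _ ≤ a₀ * E := mul_le_mul (le_max_right _ _) hEn hn0.le ha₀0.le
  -- `n! ≤ nⁿ ≤ Eⁿ`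
  have hfact : (n.factorial : ℝ) ≤ E ^ n := by
    calc (n.factorial : ℝ) ≤ ((n ^ n : ℕ) : ℝ) := by exact_mod_cast Nat.factorial_le_pow n
      _ = (n : ℝ) ^ n := by push_cast; ring
      _ ≤ E ^ n := pow_le_pow_left₀ hn0.le hEn n
  -- the product bound
  have hX : (n : ℝ) * ((n + 1) * (n : ℝ) ^ n * (n.factorial * (2 * Real.exp l₀) * (max 1 (4 * Real.exp 1 * n / l₀)) ^ n)) ≤
      (2 * Real.exp l₀) * a₀ ^ n * E ^ (3 * n + 2) := by
    have h1 : (max 1 (4 * Real.exp 1 * n / l₀)) ^ n ≤ (a₀ * E) ^ n := pow_le_pow_left₀ (by positivity) hA' n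
    calc (n : ℝ) * ((n + 1) * (n : ℝ) ^ n * (n.factorial * (2 * Real.exp l₀) * (max 1 (4 * Real.exp 1 * n / l₀)) ^ n))
        = (2 * Real.exp l₀) * ((n : ℝ) * (n + 1) * (n : ℝ) ^ n * n.factorial * (max 1 (4 * Real.exp 1 * n / l₀)) ^ n) := by ring
      _ ≤ (2 * Real.exp l₀) * (E * E * E ^ n * E ^ n * (a₀ * E) ^ n) := by
          refine mul_le_mul_of_nonneg_left ?_ (by positivity)
          refine mul_le_mul ?_ h1 (by positivity) (by positivity)
          refine mul_le_mul ?_ hfact (by positivity) (by positivity)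
          refine mul_le_mul ?_ (pow_le_pow_left₀ hn0.le hEn n) (by positivity) (by positivity)
          exact mul_le_mul hEn hEn1 (by positivity) hE0.le
      _ = (2 * Real.exp l₀) * a₀ ^ n * E ^ (3 * n + 2) := by rw [mul_pow]; ring
  have hXpos : 0 < (n : ℝ) * ((n + 1) * (n : ℝ) ^ n * (n.factorial * (2 * Real.exp l₀) * (max 1 (4 * Real.exp 1 * n / l₀)) ^ n)) := by
    positivity
  -- take logarithms
  have hlogY : Real.log ((2 * Real.exp l₀) * a₀ ^ n * E ^ (3 * n + 2)) = Real.log 2 + l₀ + n * Real.log a₀ + (3 * n + 2) * ℓ := by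
    rw [Real.log_mul (by positivity) (by positivity), Real.log_mul (by positivity) (by positivity),
      Real.log_mul (by norm_num) (Real.exp_pos _).ne', Real.log_exp, Real.log_pow, Real.log_pow, hℓ]
    push_cast
    ring
  have hlog2 : Real.log 2 ≤ 1 := by
    have := Real.log_le_sub_one_of_pos (by norm_num : (0 : ℝ) < 2); linarith
  have ha₀log : 0 ≤ Real.log a₀ := Real.log_nonneg ha₀1
  have hnℓ : 1 ≤ (n : ℝ) * ℓ := by nlinarith
  calc Real.log ((n : ℝ) * ((n + 1) * (n : ℝ) ^ n * (n.factorial * (2 * Real.exp l₀) * (max 1 (4 * Real.exp 1 * n / l₀)) ^ n)))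
      ≤ Real.log ((2 * Real.exp l₀) * a₀ ^ n * E ^ (3 * n + 2)) := Real.log_le_log hXpos hX
    _ = Real.log 2 + l₀ + n * Real.log a₀ + (3 * n + 2) * ℓ := hlogY
    _ ≤ (n * ℓ) + l₀ * (n * ℓ) + Real.log a₀ * (n * ℓ) + 5 * (n * ℓ) := by
        have h1 : Real.log 2 ≤ n * ℓ := hlog2.trans hnℓ
        have h2 : l₀ ≤ l₀ * (n * ℓ) := le_mul_of_one_le_right hl₀.le hnℓ
        have h3 : (n : ℝ) * Real.log a₀ ≤ Real.log a₀ * (n * ℓ) := by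
          calc (n : ℝ) * Real.log a₀ = Real.log a₀ * (n * 1) := by ring
            _ ≤ Real.log a₀ * (n * ℓ) := mul_le_mul_of_nonneg_left (mul_le_mul_of_nonneg_left hℓ1 hn0.le) ha₀log
        have h4 : (3 * (n : ℝ) + 2) * ℓ ≤ 5 * (n * ℓ) := by
          have h5 : 0 ≤ ((n : ℝ) - 1) * ℓ := mul_nonneg (sub_nonneg.2 hnr) (zero_le_one.trans hℓ1)
          nlinarith [h5]
        linarith
    _ = (6 + l₀ + Real.log (max 1 (4 * Real.exp 1 / l₀))) * (n * Real.log (Real.exp 1 + n)) := by rw [ha₀, hℓ, hE]; ring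

/-! ## §2 The level `n = max{m : 2c·m·log(e+m) ≤ L}` -/

/-- **THE LEVEL.**  For `c ≥ 6` and `L ≥ 2c·log(e+1)` there is `n ≥ 1` with `2c·n·log(e+n) ≤ L` and `1∕n ≤ 16c·log(e+L)∕(1+L)` (the largest
admissible `n`, by `Nat.find`; `n ≤ L`, `e+n+1 ≤ (e+L)²`). [folklore] -/
theorem exists_level {c : ℝ} (hc : 6 ≤ c) {L : ℝ} (hL : 2 * c * Real.log (Real.exp 1 + 1) ≤ L) :
    ∃ n : ℕ, 1 ≤ n ∧ 2 * c * (n * Real.log (Real.exp 1 + n)) ≤ L ∧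
      1 / (n : ℝ) ≤ 16 * c * Real.log (Real.exp 1 + L) / (1 + L) := by
  have hc0 : 0 < c := by linarith
  have he0 : 0 < Real.exp 1 := Real.exp_pos 1
  have hlog1 : ∀ x : ℝ, 0 ≤ x → 1 ≤ Real.log (Real.exp 1 + x) := fun x hx => by
    calc (1 : ℝ) = Real.log (Real.exp 1) := (Real.log_exp 1).symm
      _ ≤ Real.log (Real.exp 1 + x) := Real.log_le_log he0 (by linarith)
  have hL12 : 12 ≤ L := by
    have := hlog1 1 zero_le_one
    nlinarith
  have hL0 : 0 ≤ L := by linarith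
  -- the predicate `L < 2c (m+1) log(e+m+1)` holds for large `m`
  set P : ℕ → Prop := fun m => L < 2 * c * (((m : ℝ) + 1) * Real.log (Real.exp 1 + ((m : ℝ) + 1))) with hP
  have hex : ∃ m, P m := by
    refine ⟨⌈L⌉₊, ?_⟩
    simp only [hP]
    have h1 : L ≤ ⌈L⌉₊ := Nat.le_ceil L
    have h2 := hlog1 ((⌈L⌉₊ : ℝ) + 1) (by positivity)
    have h3 : (⌈L⌉₊ : ℝ) + 1 ≤ ((⌈L⌉₊ : ℝ) + 1) * Real.log (Real.exp 1 + ((⌈L⌉₊ : ℝ) + 1)) :=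
      le_mul_of_one_le_right (by positivity) h2
    have h4 : ((⌈L⌉₊ : ℝ) + 1) * Real.log (Real.exp 1 + ((⌈L⌉₊ : ℝ) + 1)) ≤
        2 * c * (((⌈L⌉₊ : ℝ) + 1) * Real.log (Real.exp 1 + ((⌈L⌉₊ : ℝ) + 1))) :=
      le_mul_of_one_le_left (by positivity) (by linarith)
    linarith
  classical
  let n := Nat.find hex
  have hspec : P n := Nat.find_spec hex
  have hn0 : n ≠ 0 := by
    intro h
    have h1 : P 0 := by simpa [n, h] using hspec
    simp only [hP, Nat.cast_zero, zero_add, one_mul] at h1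
    linarith
  obtain ⟨k, hk⟩ := Nat.exists_eq_succ_of_ne_zero hn0
  have hmin : ¬ P k := Nat.find_min hex (by rw [show Nat.find hex = n from rfl, hk]; exact Nat.lt_succ_self k)
  have hnk : (n : ℝ) = k + 1 := by rw [show (n : ℕ) = k.succ from hk]; push_cast; ring
  simp only [hP, not_lt] at hmin hspec
  -- so `2c n log(e+n) ≤ L < 2c (n+1) log(e+n+1)`
  have hn1 : 1 ≤ n := Nat.pos_of_ne_zero hn0
  have hnr1 : (1 : ℝ) ≤ n := by exact_mod_cast hn1
  have hnpos : (0 : ℝ) < n := by linarith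
  have hlow : 2 * c * ((n : ℝ) * Real.log (Real.exp 1 + n)) ≤ L := by rw [hnk]; exact hmin
  refine ⟨n, hn1, hlow, ?_⟩
  -- `n ≤ L`
  have hnL : (n : ℝ) ≤ L := by
    have h1 := hlog1 n hnpos.le
    have h3 : (n : ℝ) ≤ (n : ℝ) * Real.log (Real.exp 1 + n) := le_mul_of_one_le_right hnpos.le h1
    have h4 : (n : ℝ) * Real.log (Real.exp 1 + n) ≤ 2 * c * ((n : ℝ) * Real.log (Real.exp 1 + n)) :=
      le_mul_of_one_le_left (by positivity) (by linarith)
    linarith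
  -- `log(e+n+1) ≤ 2 log(e+L)`
  have hlogn : Real.log (Real.exp 1 + ((n : ℝ) + 1)) ≤ 2 * Real.log (Real.exp 1 + L) := by
    have hsq : Real.log ((Real.exp 1 + L) ^ 2) = 2 * Real.log (Real.exp 1 + L) := by
      rw [Real.log_pow]; norm_num
    rw [← hsq]
    refine Real.log_le_log (by positivity) ?_
    have he2 : (2 : ℝ) ≤ Real.exp 1 := by have := Real.add_one_le_exp (1 : ℝ); linarith
    nlinarith
  have hup : L < 2 * c * (((n : ℝ) + 1) * Real.log (Real.exp 1 + ((n : ℝ) + 1))) := hspec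
  have hlogL : 1 ≤ Real.log (Real.exp 1 + L) := hlog1 L hL0
  -- `L < 8c n log(e+L)`
  have hkey : L < 8 * c * n * Real.log (Real.exp 1 + L) := by
    have h1 : ((n : ℝ) + 1) * Real.log (Real.exp 1 + ((n : ℝ) + 1)) ≤ (2 * n) * (2 * Real.log (Real.exp 1 + L)) :=
      mul_le_mul (by linarith) hlogn (by linarith [hlog1 ((n : ℝ) + 1) (by positivity)]) (by positivity)
    nlinarith
  rw [div_le_div_iff₀ hnpos (by linarith), one_mul]
  nlinarith

/-! ## §3 THE LAW-LEVEL PRICE FROM ABOVE: `C(l₀)·(K+G)·log(e+L)∕(1+L)` -/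

section Price

variable {μ ν : Measure ℝ} [IsProbabilityMeasure μ] [IsProbabilityMeasure ν]

/-- The trivial bound: `|∫ g dκ| ≤ G` for a law on `[−1,1]` and `|g| ≤ G` there. [folklore] -/
theorem abs_integral_le_of_Icc_symm {κ : Measure ℝ} [IsProbabilityMeasure κ] (hκ : κ (Set.Icc (-1) 1)ᶜ = 0) {g : ℝ → ℝ} {G : ℝ}
    (hG : ∀ x ∈ Set.Icc (-1 : ℝ) 1, |g x| ≤ G) : |∫ x, g x ∂κ| ≤ G := by
  have hae : ∀ᵐ x ∂κ, x ∈ Set.Icc (-1 : ℝ) 1 := by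
    rw [ae_iff]
    simpa only [Set.mem_Icc, Set.compl_def] using hκ
  have h := norm_integral_le_of_norm_le_const (μ := κ) (f := g) (C := G)
    (hae.mono fun x hx => by rw [Real.norm_eq_abs]; exact hG x hx)
  rwa [probReal_univ, mul_one, Real.norm_eq_abs] at h

/-- **★★ THE LAW-LEVEL PRICE FROM ABOVE IS `C(l₀)·log(e+L)∕(1+L)`.**  Two probability laws `μ, ν` on `[−1,1]` with cgf's `ε`-close on `|t| ≤ l₀`
(`0 < l₀`, `0 < ε ≤ 1`), `g` `K`-Lipschitz with `|g| ≤ G` on `[−1,1]`: `|∫ g dν − ∫ g dμ| ≤ 384·c(l₀)·(K+G)·log(e+L)∕(1+L)`, `L = log⁺ε⁻¹`,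
`c(l₀) = 6 + l₀ + log max(1, 4e∕l₀)` — the Jackson road (p554543) at the level of §2.  Matches the lower rate `log(e+L)∕(12(1+L))` of p553677 up to
the `l₀`-constant; supersedes the `√`-type moduli of the Bernstein road (p548987 `law_controlled_of_cgf_close`, p550501 `…_symm`). [folklore] -/
theorem law_price_le_logRate (hμ : μ (Set.Icc (-1) 1)ᶜ = 0) (hν : ν (Set.Icc (-1) 1)ᶜ = 0) {ε l₀ : ℝ} (hl₀ : 0 < l₀)
    (hε : 0 < ε) (hε1 : ε ≤ 1) (hclose : ∀ t : ℝ, |t| ≤ l₀ → |cgf id ν t - cgf id μ t| ≤ ε)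
    {g : ℝ → ℝ} {K : NNReal} (hg : LipschitzWith K g) {G : ℝ} (hG : ∀ x ∈ Set.Icc (-1 : ℝ) 1, |g x| ≤ G) :
    |∫ x, g x ∂ν - ∫ x, g x ∂μ| ≤
      384 * (6 + l₀ + Real.log (max 1 (4 * Real.exp 1 / l₀))) * (K + G) *
        (Real.log (Real.exp 1 + Real.posLog ε⁻¹) / (1 + Real.posLog ε⁻¹)) := by
  set c : ℝ := 6 + l₀ + Real.log (max 1 (4 * Real.exp 1 / l₀)) with hc
  have hc6 : 6 ≤ c := by
    have := Real.log_nonneg (le_max_left 1 (4 * Real.exp 1 / l₀)); rw [hc]; linarith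
  have hc0 : 0 < c := by linarith
  set L : ℝ := Real.posLog ε⁻¹ with hLdef
  have hL0 : 0 ≤ L := Real.posLog_nonneg
  have hLlog : L = Real.log ε⁻¹ := Real.posLog_eq_log (by rw [abs_of_pos (inv_pos.2 hε)]; exact one_le_inv_iff₀.2 ⟨hε, hε1⟩)
  have hG0 : 0 ≤ G := (abs_nonneg _).trans (hG 0 (by norm_num))
  have hK0 : (0 : ℝ) ≤ K := K.2
  have he0 : 0 < Real.exp 1 := Real.exp_pos 1
  have hlogL : 1 ≤ Real.log (Real.exp 1 + L) := by
    calc (1 : ℝ) = Real.log (Real.exp 1) := (Real.log_exp 1).symm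
      _ ≤ Real.log (Real.exp 1 + L) := Real.log_le_log he0 (by linarith)
  have hrate0 : 0 < Real.log (Real.exp 1 + L) / (1 + L) := by positivity
  -- the trivial bound `2G`
  have htriv : |∫ x, g x ∂ν - ∫ x, g x ∂μ| ≤ 2 * G := by
    calc |∫ x, g x ∂ν - ∫ x, g x ∂μ| ≤ |∫ x, g x ∂ν| + |∫ x, g x ∂μ| := abs_sub _ _
      _ ≤ G + G := add_le_add (abs_integral_le_of_Icc_symm hν hG) (abs_integral_le_of_Icc_symm hμ hG)
      _ = 2 * G := by ring
  by_cases hsmall : L < 2 * c * Real.log (Real.exp 1 + 1)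
  · -- small `L`: the rate is bounded below, the trivial bound suffices
    have hlog2 : Real.log (Real.exp 1 + 1) ≤ 2 := by
      have h1 : Real.exp 1 + 1 ≤ Real.exp 2 := by
        have := Real.add_one_le_exp (1 : ℝ)
        have h2 : Real.exp 2 = Real.exp 1 * Real.exp 1 := by rw [← Real.exp_add]; norm_num
        nlinarith
      calc Real.log (Real.exp 1 + 1) ≤ Real.log (Real.exp 2) := Real.log_le_log (by positivity) h1
        _ = 2 := Real.log_exp 2
    have hL4 : L ≤ 4 * c := by nlinarith
    have hr : 1 / (1 + 4 * c) ≤ Real.log (Real.exp 1 + L) / (1 + L) :=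
      div_le_div₀ (by positivity) hlogL (by positivity) (by linarith)
    calc |∫ x, g x ∂ν - ∫ x, g x ∂μ| ≤ 2 * G := htriv
      _ ≤ 384 * c * (K + G) * (1 / (1 + 4 * c)) := by
          rw [mul_one_div, le_div_iff₀ (by positivity)]
          nlinarith [mul_nonneg hK0 hc0.le, mul_nonneg hG0 hc0.le]
      _ ≤ 384 * c * (K + G) * (Real.log (Real.exp 1 + L) / (1 + L)) :=
          mul_le_mul_of_nonneg_left hr (by positivity)
  · -- large `L`: the Jackson road at the level of §2
    rw [not_lt] at hsmall
    obtain ⟨n, hn1, hlow, hinv⟩ := exists_level hc6 hsmall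
    have hnr : (0 : ℝ) < n := by exact_mod_cast hn1
    have hnr1 : (1 : ℝ) ≤ n := by exact_mod_cast hn1
    set A : ℝ := max 1 (2 * Real.exp 1 * max 1 (Real.posLog ε⁻¹) / l₀) with hA
    set A' : ℝ := max 1 (4 * Real.exp 1 * n / l₀) with hA'
    set Ψ : ℝ := ((n : ℝ) + 1) * (n : ℝ) ^ n * (n.factorial * (2 * Real.exp l₀) * A' ^ n) with hΨ
    have hΨ0 : 0 < Ψ := by positivity
    -- `n·Ψ·√ε ≤ 1`
    have hconv : (n : ℝ) * Ψ * Real.sqrt ε ≤ 1 := by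
      have h1 : Real.log ((n : ℝ) * Ψ) ≤ c * (n * Real.log (Real.exp 1 + n)) := log_conversion_le hl₀ hn1
      have h2 : c * (n * Real.log (Real.exp 1 + n)) ≤ L / 2 := by linarith
      have h3 : (n : ℝ) * Ψ ≤ Real.exp (L / 2) := (Real.log_le_iff_le_exp (by positivity)).1 (h1.trans h2)
      have h4 : Real.exp (L / 2) * Real.sqrt ε = 1 := by
        rw [Real.exp_half, hLlog, Real.exp_log (inv_pos.2 hε), ← Real.sqrt_mul (inv_pos.2 hε).le, inv_mul_cancel₀ hε.ne',
          Real.sqrt_one]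
      calc (n : ℝ) * Ψ * Real.sqrt ε ≤ Real.exp (L / 2) * Real.sqrt ε := mul_le_mul_of_nonneg_right h3 (Real.sqrt_nonneg _)
        _ = 1 := h4
    -- the Jackson-road bound at level `n`
    have hJ := abs_integral_sub_integral_le_lipschitz_jackson hμ hν hl₀ hε.le hclose hg hG hn1
    have htrade : A ^ n * ε ≤ A' ^ n * Real.sqrt ε := max_pow_mul_le_sqrt hl₀ hε hε1 hn1
    have hsecond : ((n : ℝ) + 1) * (G + 8 * K / n) * (n : ℝ) ^ n * (n.factorial * (2 * ε * Real.exp l₀) * A ^ n) ≤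
        (G + 8 * K) * (Ψ * Real.sqrt ε) := by
      have h8 : G + 8 * K / n ≤ G + 8 * K := by
        have : 8 * (K : ℝ) / n ≤ 8 * K := div_le_self (by positivity) hnr1
        linarith
      calc ((n : ℝ) + 1) * (G + 8 * K / n) * (n : ℝ) ^ n * (n.factorial * (2 * ε * Real.exp l₀) * A ^ n)
          = (G + 8 * K / n) * (((n : ℝ) + 1) * (n : ℝ) ^ n * (n.factorial * (2 * Real.exp l₀)) * (A ^ n * ε)) := by ring
        _ ≤ (G + 8 * K) * (((n : ℝ) + 1) * (n : ℝ) ^ n * (n.factorial * (2 * Real.exp l₀)) * (A' ^ n * Real.sqrt ε)) :=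
            mul_le_mul h8 (mul_le_mul_of_nonneg_left htrade (by positivity)) (by positivity) (by positivity)
        _ = (G + 8 * K) * (Ψ * Real.sqrt ε) := by rw [hΨ]; ring
    have hΨε : Ψ * Real.sqrt ε ≤ 1 / n := by
      rw [le_div_iff₀ hnr]
      calc Ψ * Real.sqrt ε * n = n * Ψ * Real.sqrt ε := by ring
        _ ≤ 1 := hconv
    have hΔ : |∫ x, g x ∂ν - ∫ x, g x ∂μ| ≤ (24 * K + G) * (1 / n) := by
      calc |∫ x, g x ∂ν - ∫ x, g x ∂μ|
          ≤ 16 * K / n + ((n : ℝ) + 1) * (G + 8 * K / n) * (n : ℝ) ^ n * (n.factorial * (2 * ε * Real.exp l₀) * A ^ n) := hJ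
        _ ≤ 16 * K / n + (G + 8 * K) * (Ψ * Real.sqrt ε) := add_le_add le_rfl hsecond
        _ ≤ 16 * K / n + (G + 8 * K) * (1 / n) := add_le_add le_rfl (mul_le_mul_of_nonneg_left hΨε (by positivity))
        _ = (24 * K + G) * (1 / n) := by ring
    calc |∫ x, g x ∂ν - ∫ x, g x ∂μ| ≤ (24 * K + G) * (1 / n) := hΔ
      _ ≤ (24 * (K + G)) * (16 * c * Real.log (Real.exp 1 + L) / (1 + L)) :=
          mul_le_mul (by linarith) hinv (by positivity) (by positivity)
      _ = 384 * c * (K + G) * (Real.log (Real.exp 1 + L) / (1 + L)) := by ring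

/-! ## §4 TWO-SIDED -/

omit [IsProbabilityMeasure μ] [IsProbabilityMeasure ν] in
/-- A law on `[0,1]` is a law on `[−1,1]`. [folklore] -/
theorem Icc_symm_compl_null_of_Icc {κ : Measure ℝ} (hκ : κ (Set.Icc 0 1)ᶜ = 0) : κ (Set.Icc (-1) 1)ᶜ = 0 :=
  measure_mono_null (Set.compl_subset_compl.2 (Set.Icc_subset_Icc (by norm_num) le_rfl)) hκ

end Price

/-- **★★ THE LAW-LEVEL PRICE OF WINDOW MATCHING IS `log(e+L)∕(1+L)`, TWO-SIDED.**  For every window `0 < l₀`: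
(UPPER) for all probability laws `μ, ν` on `[−1,1]` with cgf's `ε`-close on `|t| ≤ l₀`, `0 < ε ≤ 1`, and every `K`-Lipschitz `g` with `|g| ≤ G` on
`[−1,1]`: `|∫ g dν − ∫ g dμ| ≤ 384·c(l₀)·(K+G)·log(e+L)∕(1+L)`;
(LOWER) for every `ε₀ > 0` there are probability laws `μ, ν` on `[−1,1]` (indeed on `[0,1]`) with cgf's `ε`-close on `|t| ≤ l₀`, `0 < ε ≤ min(ε₀, 1)`,
and a `1`-Lipschitz `g : ℝ → [0,1]` with `|∫ g dν − ∫ g dμ| ≥ log(e+L)∕(12(1+L))` (p553677's binomial witness) — `L = log⁺ε⁻¹`,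
`c(l₀) = 6 + l₀ + log max(1, 4e∕l₀)`.  The law analogue of p517472 `sharp_price_two_sided`. [folklore] -/
theorem law_price_two_sided {l₀ : ℝ} (hl₀ : 0 < l₀) :
    (∀ (μ ν : Measure ℝ) [IsProbabilityMeasure μ] [IsProbabilityMeasure ν],
      μ (Set.Icc (-1) 1)ᶜ = 0 → ν (Set.Icc (-1) 1)ᶜ = 0 → ∀ ε : ℝ, 0 < ε → ε ≤ 1 →
        (∀ t : ℝ, |t| ≤ l₀ → |cgf id ν t - cgf id μ t| ≤ ε) →
        ∀ (g : ℝ → ℝ) (K : NNReal) (G : ℝ), LipschitzWith K g → (∀ x ∈ Set.Icc (-1 : ℝ) 1, |g x| ≤ G) →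
          |∫ x, g x ∂ν - ∫ x, g x ∂μ| ≤
            384 * (6 + l₀ + Real.log (max 1 (4 * Real.exp 1 / l₀))) * (K + G) *
              (Real.log (Real.exp 1 + Real.posLog ε⁻¹) / (1 + Real.posLog ε⁻¹))) ∧
    (∀ ε₀ : ℝ, 0 < ε₀ → ∃ μ ν : Measure ℝ, IsProbabilityMeasure μ ∧ IsProbabilityMeasure ν ∧
      μ (Set.Icc (-1) 1)ᶜ = 0 ∧ ν (Set.Icc (-1) 1)ᶜ = 0 ∧
      ∃ ε : ℝ, 0 < ε ∧ ε ≤ min ε₀ 1 ∧ (∀ t : ℝ, |t| ≤ l₀ → |cgf id ν t - cgf id μ t| ≤ ε) ∧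
        ∃ g : ℝ → ℝ, LipschitzWith 1 g ∧ (∀ x, 0 ≤ g x ∧ g x ≤ 1) ∧
          Real.log (Real.exp 1 + Real.posLog ε⁻¹) / (12 * (1 + Real.posLog ε⁻¹)) ≤ |∫ x, g x ∂ν - ∫ x, g x ∂μ|) := by
  refine ⟨fun μ ν _ _ hμ hν ε hε hε1 hclose g K G hg hG => law_price_le_logRate hμ hν hl₀ hε hε1 hclose hg hG, fun ε₀ hε₀ => ?_⟩
  obtain ⟨μ, ν, iμ, iν, hμ, hν, ε, hε, hε1, hclose, g, hg, hg01, hrate⟩ := law_price_ge_logRate hl₀ (lt_min hε₀ one_pos)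
  exact ⟨μ, ν, iμ, iν, Icc_symm_compl_null_of_Icc hμ, Icc_symm_compl_null_of_Icc hν, ε, hε, hε1, hclose, g, hg, hg01, hrate⟩

end Summit.QuantumFields.YangMills.Theorems.BalabanUVNodesN19LawPriceTwoSided

end
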